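import Literature.Computability.Cryptography.PseudorandomGeneratorsStretchOne
import Literature.Computability.Cryptography.HybridSamplingMachine
import Literature.Computability.Complexity.PlumbingBricks
import Literature.Computability.Complexity.FoldBricks
import Literature.Computability.Complexity.CountingHierarchyProofs
import Literature.Computability.Complexity.TimeBoundsProofs
import Literature.Computability.Complexity.PairingMachines
import HarnessLib

/-!
# Pseudorandom generators on a sparse schedule of seed lengths extend to all seed lengths

The tree's `IsPRG G ℓ` / `PRGExist` (`Indistinguishability.lean`; Goldreich 2001, Def. 3.3.1) quantify
over **every** seed length: `|G s| = ℓ |s| > |s|` for all `s`, and `n ↦ G(U_n)` is pseudorandom. The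
constructions of generators from one-way functions deliver less: a generator indexed by the security
parameter `n` with seed length `d(n)` — Haitner–Reingold–Vadhan 2013, Thm. 5.1 / Thm. 6.1: "there exists a
polynomial-time computable generator `G : {0,1}^d → {0,1}^{d·(1+Ω(Δ/n))}` with seed length
`d = d(n) = O(n·m²·κ·log² n/Δ³)`" (so `d` is not even a polynomial), pseudorandom along `n`. This file
proves, once and for all, the length convention that closes the gap — the construction of Goldreich
2001, §2.2.3.1, Prop. 2.2.3, eq. (2.2) (`g'(x) = f(x')x''`, "`x'` is the longest prefix of `x` with
length in `I`", printed for one-way functions) carried out for generators: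

> if a polynomial-time `S`, run as `S⟨1ⁿ, s⟩` on seeds `|s| = d n` (`d` strictly increasing and
> computable in unary in polynomial time), has outputs of length `r n ≥ d n + 1` and `n ↦ S⟨1ⁿ, U_{d n}⟩`
> is pseudorandom against `U_{r n}`, then `PRGExt.ext d S` — on `w` with `|w| = m ≥ d 0` and `n = dOf m`
> the largest `n` with `d n ≤ m`: `ext(w) = (S⟨1ⁿ, w ↾ d n⟩) ↾ (d n + 1) ++ w ⇂ d n`; below `d 0`,
> `w ↦ w0` — is a pseudorandom generator of stretch `m + 1` (`PRGExt.isPRG_ext`), so `PRGExist`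
> (`PRGExist_of_levels`).

**The reduction** (`PRGExt.isPseudorandom_ext`). A PPT distinguisher `D` for `ext(U_m)` versus
`U_{m+1}` with advantage `adv_D(m)` yields the distinguisher `D'` (`PRGExt.adv`) for the level-indexed
ensemble: on `⟨1ⁿ, y⟩` it appends `j` fresh coins `z` to the prefix `y ↾ (d n + 1)` and runs `D` on
`⟨1^{d n + j}, y ↾ (d n + 1) ++ z⟩`. On `y = S⟨1ⁿ, s⟩`, `s ← U_{d n}`, this is `D` on `ext(U_{d n + j})`
(`PRGExt.ext_append`); on `y ← U_{r n}` it is `D` on `U_{d n + j + 1}`; so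
`adv_{D'}(n) = adv_D(d n + j)` exactly (`PRGExt.distAdvantage_adv`, by counting coin strings as uniform
averages). With `j = j(n)` an offset of level `n` maximising `adv_D` and `n'` the level maximising
`adv_D(d · + j(·))` among the levels colliding with `n` (below): for every `m ≥ d 0`, `n = dOf m`,
`adv_D(m) ≤ adv_D(d n + j(n)) ≤ adv_D(d n' + j(n')) = adv_{D'}(n')`, and `m < d(n+1) ≤ pd(n' + 2 + pr(n'))`
for polynomial bounds `pd ≥ d`, `pr ≥ r`; negligibility of `adv_{D'}` transfers to `adv_D` along this
polynomially honest re-indexing (`superpolynomialDecay_of_le_comp` of `PseudorandomGeneratorsStretchOne.lean`).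

**Two features of the tree's model of probabilistic machines** (`RandAlg`: the coin budget is an
arbitrary polynomially bounded function of the input length), handled with the devices already used in
`YaoAmplification.lean`, `OneWayFunctionsLengthPreserving.lean` and `PseudorandomGeneratorsStretchOne.lean`:
(i) neither the offset `j(n)` nor `D`'s coin count `κ` on the corresponding queries is computable, so both
are carried by the number of coins of `D'`, `|r| = j·K n + κ` with `K n = q_D(3·pd(n+1)+3) + 1 > κ`
(`PRGExt.Setting.Code`; `D'` decodes by `div`/`mod`, `PRGExt.advCore`); (ii) the input length
`2n + 2 + r n` of `D'` need not determine `n` (nothing is assumed about `r` beyond `r n ≥ d n + 1`), so the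
budget of an input length `L` is that of the level in the collision class `{n : 2n + 2 + r n = L}` with
the largest advised advantage (`PRGTake.sel`; `PRGExt.Setting.σ`, `cl`) — at that level `D'` is exactly
right, and every level is dominated by the selected level of its class. The budget is polynomially
bounded (`PRGExt.Setting.cl_le`), which is all `IsPPT` asks of it.

## Main statements

* `PRGExt.dOf`, `PRGExt.ext`, `PRGExt.levelEnsemble`, `PRGExt.OutLen`, `PRGExt.dF` (the schedule in unary);
* `PRGExt.length_ext`, `PRGExt.ext_mem_FP` (clocked search for the level, then `take`/`drop`/concatenation
  bricks — no machine is programmed), `PRGExt.isPseudorandom_ext`, `PRGExt.isPRG_ext`;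
* `PRGExist_of_levels`.

## References

* O. Goldreich, *Foundations of Cryptography I: Basic Tools*, Cambridge University Press 2001 (2004
  printing, doi:10.1017/CBO9780511721656), §2.2.3.1 (Prop. 2.2.3, eqs. (2.1)–(2.2): functions defined only
  for some lengths), Def. 3.3.1 (pseudorandom generators), Def. 3.2.2, §1.3.2.
* I. Haitner, O. Reingold, S. Vadhan, *Efficiency improvements in constructing pseudorandom generators
  from one-way functions*, SIAM J. Comput. 42(3) (2013), Def. 2.3, Thms. 5.1, 6.1 (generators with seed
  length `d(n)` indexed by the security parameter).
* S. Arora, B. Barak, *Computational Complexity: A Modern Approach*, CUP 2009, §1.3, §1.4.1, §7.1 — the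
  machine toolkit.
-/

namespace Literature.Computability.Cryptography

open Filter Asymptotics _root_.Computability Complexity Finset Polynomial

namespace PRGExt

/-! ### The schedule of seed lengths and the level of a length -/

section Levels

variable (d : ℕ → ℕ)

/-- The level of the seed length `m`: the largest `n ≤ m` with `d n ≤ m` (the length in `I = {d n}`
of "the longest prefix of `x` with length in `I`"). [Goldreich 2001, §2.2.3.1, eq. (2.2)] [folklore] -/
def dOf (m : ℕ) : ℕ := Nat.findGreatest (fun n => d n ≤ m) m

variable {d}

/-- `d (dOf m) ≤ m` once `d 0 ≤ m`. [folklore] -/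
theorem d_dOf_le {m : ℕ} (hm : d 0 ≤ m) : d (dOf d m) ≤ m :=
  Nat.findGreatest_spec (P := fun n => d n ≤ m) (Nat.zero_le m) hm

/-- `m < d (dOf m + 1)` for a strictly increasing schedule. [folklore] -/
theorem lt_d_dOf_succ (hd : StrictMono d) (m : ℕ) : m < d (dOf d m + 1) := by
  by_contra h
  push Not at h
  have hle : dOf d m + 1 ≤ m := (hd.id_le _).trans h
  have := Nat.le_findGreatest (P := fun n => d n ≤ m) hle h
  unfold dOf at this
  omega

/-- `d n ≤ m < d (n+1)` gives `dOf m = n`. [folklore] -/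
theorem dOf_eq (hd : StrictMono d) {n m : ℕ} (h1 : d n ≤ m) (h2 : m < d (n + 1)) : dOf d m = n := by
  have ha : d (dOf d m) ≤ m := d_dOf_le ((hd.monotone (Nat.zero_le n)).trans h1)
  have hb : m < d (dOf d m + 1) := lt_d_dOf_succ hd m
  have h3 : dOf d m < n + 1 := hd.lt_iff_lt.1 (ha.trans_lt h2)
  have h4 : n < dOf d m + 1 := hd.lt_iff_lt.1 (h1.trans_lt hb)
  omega

/-- `dOf m ≤ m`. [folklore] -/
theorem dOf_le (m : ℕ) : dOf d m ≤ m := Nat.findGreatest_le m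

end Levels

/-! ### The generator on all seed lengths -/

/-- **The extension of a level-indexed generator to all seed lengths** (the construction of
Goldreich 2001, Prop. 2.2.3, eq. (2.2), `g'(x) = f(x')x''`, for generators): on `w` of length
`m ≥ d 0`, with `n = dOf m`, run the level-`n` generator `S⟨1ⁿ, ·⟩` on the first `d n` bits, keep the
first `d n + 1` output bits, and copy the suffix `w ⇂ d n` verbatim; below `d 0` output `w0` (any
stretching map will do on finitely many lengths). [Goldreich 2001, §2.2.3.1, eq. (2.2) (for one-way
functions)] [folklore] -/
def ext (d : ℕ → ℕ) (S : List Bool → List Bool) (w : List Bool) : List Bool :=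
  if d 0 ≤ w.length then
    (S (boolPair (unaryEncodeNat (dOf d w.length)) (w.take (d (dOf d w.length))))).take (d (dOf d w.length) + 1) ++
      w.drop (d (dOf d w.length))
  else w ++ [false]

/-- The output-length clause of the level-indexed generator: on `⟨1ⁿ, s⟩` with `|s| = d n` the output
has length `r n`. [folklore] -/
def OutLen (d r : ℕ → ℕ) (S : List Bool → List Bool) : Prop :=
  ∀ n s, s.length = d n → (S (boolPair (unaryEncodeNat n) s)).length = r n

/-- **The level-indexed ensemble** `n ↦ S⟨1ⁿ, U_{d n}⟩` (the tree's `seedEnsemble` for a general,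
not necessarily polynomial, schedule `d`). [Goldreich 2001, Def. 3.2.5 / Def. 3.3.1] [folklore] -/
noncomputable def levelEnsemble (d : ℕ → ℕ) (S : List Bool → List Bool) : Ensemble (List Bool) :=
  fun n => (uniformBits (d n)).map fun s => S (boolPair (unaryEncodeNat n) s)

variable {d r : ℕ → ℕ} {S : List Bool → List Bool}

/-- On level `n`: `ext d S w = (S⟨1ⁿ, w ↾ d n⟩) ↾ (d n + 1) ++ w ⇂ d n` for `d n ≤ |w| < d (n+1)`. [folklore] -/
theorem ext_eq_of_level (hd : StrictMono d) {n : ℕ} {w : List Bool} (h1 : d n ≤ w.length) (h2 : w.length < d (n + 1)) :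
    ext d S w = (S (boolPair (unaryEncodeNat n) (w.take (d n)))).take (d n + 1) ++ w.drop (d n) := by
  have hn : dOf d w.length = n := dOf_eq hd h1 h2
  have h0 : d 0 ≤ w.length := (hd.monotone (Nat.zero_le n)).trans h1
  simp only [ext, if_pos h0, hn]

/-- **`ext d S` stretches every seed by one bit** (given `d n + 1 ≤ r n`). [folklore] -/
theorem length_ext (hS : OutLen d r S) (hr : ∀ n, d n + 1 ≤ r n) (w : List Bool) :
    (ext d S w).length = w.length + 1 := by
  unfold ext
  split_ifs with h0
  · have h1 := d_dOf_le (d := d) h0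
    rw [List.length_append, List.length_take, List.length_drop,
      hS _ _ (by rw [List.length_take]; omega)]
    have := hr (dOf d w.length)
    omega
  · simp

/-- **A level-`n` output with a uniform suffix is a sample of the extension**: for `|s| = d n`,
`|z| = j`, `d n + j < d (n+1)`: `ext d S (s ++ z) = (S⟨1ⁿ, s⟩) ↾ (d n + 1) ++ z`. [folklore] -/
theorem ext_append (hd : StrictMono d) {n j : ℕ} (hj : d n + j < d (n + 1)) {s z : List Bool}
    (hs : s.length = d n) (hz : z.length = j) :
    ext d S (s ++ z) = (S (boolPair (unaryEncodeNat n) s)).take (d n + 1) ++ z := by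
  rw [ext_eq_of_level hd (n := n) (by simp [hs]) (by simp [hs, hz]; omega), List.take_left' hs, List.drop_left' hs]

/-! ### `ext d S` is polynomial-time computable -/

section Program

open Complexity.Brick Complexity.Plumb Complexity.OracleCompose

variable (d)

/-- **The schedule in unary**: `dF d u = 1^{d |u|}`. Its membership in `FP` ("`d` is computable in
unary in polynomial time", which also makes `d` polynomially bounded) is the computability hypothesis
on the schedule. [folklore] -/
def dF : List Bool → List Bool := fun u => ones (d u.length)

/-- The search step: `k ↦ k + 1` while `d (k+1) ≤ m` (the clocked search of `YaoFunProgram.lean` /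
`OneWayFunctionsLengthPreserving.lean` for a general schedule). [folklore] -/
def nstep (m k : ℕ) : ℕ := if d (k + 1) ≤ m then k + 1 else k

/-- The stop condition `[|w| < d (k+1)]` on the search state `⟨w, 1ᵏ⟩`. [folklore] -/
noncomputable def dOfCond : List Bool → List Bool := ltLenF ∘ fanoutFn fstF (dF d ∘ List.cons true ∘ sndF)

/-- One round of the search on `⟨w, 1ᵏ⟩`. [folklore] -/
noncomputable def dOfRound : List Bool → List Bool :=
  fanoutFn fstF (iteFn (dOfCond d) sndF (List.cons true ∘ sndF))

/-- Value of the stop condition. [folklore] -/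
theorem dOfCond_state (w : List Bool) (k : ℕ) :
    dOfCond d (boolPair w (ones k)) = [decide (w.length < d (k + 1))] := by
  simp [dOfCond, dF]

/-- Value of one round. [folklore] -/
theorem dOfRound_state (w : List Bool) (k : ℕ) :
    dOfRound d (boolPair w (ones k)) = boolPair w (ones (nstep d w.length k)) := by
  unfold dOfRound nstep
  rw [fanoutFn_apply, fstF_boolPair]
  by_cases h : d (k + 1) ≤ w.length
  · rw [iteFn_apply_false (by rw [dOfCond_state, decide_eq_false (by omega)]), if_pos h]
    simp [List.replicate_succ]
  · rw [iteFn_apply_true (by rw [dOfCond_state, decide_eq_true (by omega)]), if_neg h]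
    simp

/-- The stop condition is one bit. [folklore] -/
theorem dOfCond_eq_or (z : List Bool) : dOfCond d z = [true] ∨ dOfCond d z = [false] := by
  unfold dOfCond ltLenF
  simp only [Function.comp_apply]
  exact lenLeFn_eq_or X _

/-- Additive growth of one round. [folklore] -/
theorem length_dOfRound_le (w : List Bool) : (dOfRound d w).length ≤ w.length + 3 := by
  have h1 := length_boolUnpair_parts_le w
  unfold dOfRound
  rcases dOfCond_eq_or d w with h | h
  · rw [fanoutFn_apply, iteFn_apply_true h]
    simp only [length_boolPair, fstF, sndF]; omega
  · rw [fanoutFn_apply, iteFn_apply_false h]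
    simp only [length_boolPair, fstF, sndF, Function.comp_apply, List.length_cons]; omega

variable {d}

/-- **The search computes `dOf`**: after `j ≤ m` rounds the counter is `min j (dOf m)`. [folklore] -/
theorem iterate_nstep (hd : StrictMono d) (m : ℕ) : ∀ j, j ≤ m → (nstep d m)^[j] 0 = min j (dOf d m)
  | 0, _ => by simp
  | j + 1, hj => by
    rw [Function.iterate_succ_apply', iterate_nstep hd m j (by omega)]
    have hGm : dOf d m ≤ m := Nat.findGreatest_le m
    have hG2 : ∀ n, dOf d m < n → n ≤ m → ¬ d n ≤ m := fun n h1 h2 =>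
      Nat.findGreatest_is_greatest (P := fun k => d k ≤ m) h1 h2
    unfold nstep
    by_cases hjG : j < dOf d m
    · have hG1 : d (dOf d m) ≤ m := by
        by_cases h0 : d 0 ≤ m
        · exact d_dOf_le h0
        · exfalso
          have : dOf d m = 0 := by
            unfold dOf
            rw [Nat.findGreatest_eq_zero_iff]
            intro k _ _ hk
            exact h0 ((hd.monotone (Nat.zero_le k)).trans hk)
          omega
      rw [min_eq_left hjG.le, if_pos ((hd.monotone (by omega)).trans hG1), min_eq_left (by omega)]
    · rw [min_eq_right (by omega), if_neg (hG2 _ (Nat.lt_succ_self _) (by omega)), min_eq_right (by omega)]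

variable (d)

/-- Rounds of the search on a state. [folklore] -/
theorem iterate_dOfRound (w : List Bool) :
    ∀ j, (dOfRound d)^[j] (boolPair w (ones 0)) = boolPair w (ones ((nstep d w.length)^[j] 0))
  | 0 => rfl
  | j + 1 => by rw [Function.iterate_succ_apply', iterate_dOfRound w j, dOfRound_state, Function.iterate_succ_apply']

/-- **`dOfFn w = 1^{dOf |w|}`**: the level in unary, by `|w|` rounds of the search. [folklore] -/
noncomputable def dOfFn : List Bool → List Bool :=
  sndF ∘ (fun z => (dOfRound d)^[X.eval (boolUnpair z).1.length] z) ∘ fanoutFn id (fun _ => [])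

variable {d}

/-- Value of `dOfFn`. [folklore] -/
theorem dOfFn_apply (hd : StrictMono d) (w : List Bool) : dOfFn d w = ones (dOf d w.length) := by
  have h := iterate_dOfRound d w w.length
  rw [iterate_nstep hd w.length w.length le_rfl, min_eq_right (dOf_le _)] at h
  simp only [dOfFn, Function.comp_apply, fanoutFn_apply, id, boolUnpair_boolPair, eval_X]
  rw [show (boolPair w [] : List Bool) = boolPair w (ones 0) from rfl, h, sndF_boolPair]

/-- `dOfFn ∈ FP` when the schedule is computable in unary. [Arora–Barak 2009, §1.4.1 (clocked loops)] [folklore] -/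
theorem dOfFn_mem_FP (hdF : dF d ∈ FP) : dOfFn d ∈ FP :=
  comp_mem_FP sndF_mem_FP (comp_mem_FP
    (iterate_mem_FP (fanoutFn_mem_FP fstF_mem_FP (iteFn_mem_FP
      (comp_mem_FP ltLenF_mem_FP (fanoutFn_mem_FP fstF_mem_FP (comp_mem_FP hdF (comp_mem_FP (cons_mem_FP true) sndF_mem_FP))))
      sndF_mem_FP (comp_mem_FP (cons_mem_FP true) sndF_mem_FP))) 3 (length_dOfRound_le d) X)
    (fanoutFn_mem_FP OracleCompose.id_mem_FP (const_mem_FP [])))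

variable (d S)

/-- `1^{d n}`, `n = dOf |w|`. [folklore] -/
noncomputable def DnF : List Bool → List Bool := dF d ∘ dOfFn d

/-- The level branch `(S⟨1ⁿ, w ↾ d n⟩) ↾ (d n + 1) ++ w ⇂ d n`. [folklore] -/
noncomputable def mainF : List Bool → List Bool :=
  concatFn ∘ fanoutFn
    (takeFn ∘ fanoutFn (List.cons true ∘ DnF d) (S ∘ fanoutFn (dOfFn d) (takeFn ∘ fanoutFn (DnF d) id)))
    (dropFn ∘ fanoutFn (DnF d) id)

/-- **`ext d S` as a brick pipeline**: `w0` below length `d 0`, the level branch otherwise. [folklore] -/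
noncomputable def extF : List Bool → List Bool :=
  iteFn (ltLenF ∘ fanoutFn id (fun _ => ones (d 0))) (concatFn ∘ fanoutFn id (fun _ => [false])) (mainF d S)

variable {d S}

/-- Value of `mainF`. [folklore] -/
theorem mainF_apply (hd : StrictMono d) (w : List Bool) :
    mainF d S w = (S (boolPair (unaryEncodeNat (dOf d w.length)) (w.take (d (dOf d w.length))))).take
        (d (dOf d w.length) + 1) ++ w.drop (d (dOf d w.length)) := by
  have hD : DnF d w = ones (d (dOf d w.length)) := by
    simp [DnF, dF, dOfFn_apply hd]
  simp only [mainF, Function.comp_apply, fanoutFn_apply, hD, dOfFn_apply hd, id, takeFn_boolPair, dropFn_boolPair,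
    concatFn_boolPair, List.length_cons, List.length_replicate, Complexity.unaryEncodeNat_eq_replicate]

/-- **The pipeline computes `ext d S`.** [folklore] -/
theorem extF_eq (hd : StrictMono d) : extF d S = ext d S := by
  funext w
  have hc : (ltLenF ∘ fanoutFn id (fun _ => ones (d 0))) w = [decide (w.length < d 0)] := by simp
  unfold extF ext
  by_cases h0 : d 0 ≤ w.length
  · rw [iteFn_apply_false (by rw [hc, decide_eq_false (by omega)]), if_pos h0, mainF_apply hd]
  · rw [iteFn_apply_true (by rw [hc, decide_eq_true (by omega)]), if_neg h0]
    simp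

/-- **`ext d S` is polynomial-time computable** for `S ∈ FP` and a schedule computable in unary.
[Goldreich 2001, Prop. 2.2.3 (`g'` is polynomial-time)] [folklore] -/
theorem ext_mem_FP (hd : StrictMono d) (hdF : dF d ∈ FP) (hS : S ∈ FP) : ext d S ∈ FP := by
  rw [← extF_eq hd]
  have hDn : DnF d ∈ FP := comp_mem_FP hdF (dOfFn_mem_FP hdF)
  have hmain : mainF d S ∈ FP := comp_mem_FP concatFn_mem_FP (fanoutFn_mem_FP
    (comp_mem_FP takeFn_mem_FP (fanoutFn_mem_FP (comp_mem_FP (cons_mem_FP true) hDn)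
      (comp_mem_FP hS (fanoutFn_mem_FP (dOfFn_mem_FP hdF) (comp_mem_FP takeFn_mem_FP (fanoutFn_mem_FP hDn id_mem_FP))))))
    (comp_mem_FP dropFn_mem_FP (fanoutFn_mem_FP hDn id_mem_FP)))
  exact iteFn_mem_FP (comp_mem_FP ltLenF_mem_FP (fanoutFn_mem_FP id_mem_FP (const_mem_FP _)))
    (comp_mem_FP concatFn_mem_FP (fanoutFn_mem_FP id_mem_FP (const_mem_FP _))) hmain

/-- The schedule is polynomially bounded when computable in unary. [Arora–Barak 2009, §1.3] [folklore] -/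
theorem exists_poly_d_le (hdF : dF d ∈ FP) : ∃ pd : Polynomial ℕ, ∀ n, d n ≤ pd.eval n := by
  obtain ⟨pd, hpd⟩ := exists_poly_length_le_of_mem_FP hdF
  refine ⟨pd, fun n => ?_⟩
  have h := hpd (ones n)
  simpa [dF] using h

end Program

/-! ### The distinguisher for the level-indexed generator built from a distinguisher for `ext` -/

section Adversary

open Complexity.Brick Complexity.Plumb Complexity.OracleCompose

/-- `|1ⁿ| = n`. [folklore] -/
private theorem length_unaryEncodeNat (n : ℕ) : (unaryEncodeNat n).length = n := unary_decode_encode_nat n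

variable (d) (D : RandAlg (List Bool) Bool) (qD pd : Polynomial ℕ)

/-- A bound `K n = q_D(3 pd(n+1) + 3) + 1` exceeding the coin count of `D` on every query of level `n`
(`q_D` bounds `D`'s coin budget, `pd` bounds the schedule). [folklore] -/
noncomputable def Kpoly : Polynomial ℕ := qD.comp (C 3 * pd.comp (X + 1) + C 3) + 1

/-- `K n`. [folklore] -/
noncomputable def K (n : ℕ) : ℕ := (Kpoly qD pd).eval n

/-- Value of `K`. [folklore] -/
theorem K_eq (n : ℕ) : K qD pd n = qD.eval (3 * pd.eval (n + 1) + 3) + 1 := by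
  simp [K, Kpoly]

/-- **The query** of level `n` for the sample `y` and the suffix `z`: `⟨1^{d n + |z|}, y ↾ (d n + 1) ++ z⟩`. [folklore] -/
def query (n : ℕ) (y z : List Bool) : List Bool :=
  boolPair (unaryEncodeNat (d n + z.length)) (y.take (d n + 1) ++ z)

/-- **The run of the new distinguisher** on `(n, y)` with coins `r`: decode
`(j, κ) = (|r| / K n, |r| mod K n)`, run `D` on `⟨1^{d n + j}, y ↾ (d n + 1) ++ r ↾ j⟩` with the next
`κ` coins (the coin-count device of `YaoAmplification.lean`). [folklore] -/
noncomputable def advCore (n : ℕ) (y r : List Bool) : Bool :=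
  D.run (query d n y (r.take (r.length / K qD pd n)))
    ((r.drop (r.length / K qD pd n)).take (r.length % K qD pd n))

/-- The run function on the input `⟨1ⁿ, y⟩`. [folklore] -/
noncomputable def advRun (inp r : List Bool) : Bool := advCore d D qD pd (boolUnpair inp).1.length (boolUnpair inp).2 r

/-- **The distinguisher `D'` for the level-indexed ensemble** with a prescribed coin budget `cl`. [folklore] -/
noncomputable def adv (cl : ℕ → ℕ) : RandAlg (List Bool) Bool where
  run := advRun d D qD pd
  coinLen := cl

variable {d D qD pd}

/-- The run on a well-formed input. [folklore] -/
theorem advRun_boolPair (n : ℕ) (y r : List Bool) :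
    advRun d D qD pd (boolPair (unaryEncodeNat n) y) r = advCore d D qD pd n y r := by
  simp [advRun]

/-- Length of a query of level `n` with `|z| = j` and `|y| ≥ d n + 1`: `3(d n + j) + 3`. [folklore] -/
theorem length_query {n : ℕ} {y z : List Bool} (hy : d n + 1 ≤ y.length) :
    (query d n y z).length = 3 * (d n + z.length) + 3 := by
  simp only [query, length_boolPair, length_unaryEncodeNat, List.length_append, List.length_take, min_eq_left hy]
  ring

/-! #### `D'` is PPT: the run function as a brick pipeline on `⟨inp, r⟩` -/

variable (d D qD pd)

/-- `1ⁿ`. [folklore] -/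
noncomputable def uF : List Bool → List Bool := onesFn ∘ fstF ∘ fstF
/-- `1^{K n}`. [folklore] -/
noncomputable def kF : List Bool → List Bool := polyFn (Kpoly qD pd) ∘ uF
/-- `⟨1^{|r| / K n}, 1^{|r| mod K n}⟩`. [folklore] -/
noncomputable def dmF : List Bool → List Bool := divModFn ∘ fanoutFn (kF qD pd) (onesFn ∘ sndF)
/-- `z = r ↾ j`. [folklore] -/
noncomputable def zF : List Bool → List Bool := takeFn ∘ fanoutFn (fstF ∘ dmF qD pd) sndF
/-- `D`'s coins `(r ⇂ j) ↾ κ`. [folklore] -/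
noncomputable def rAF : List Bool → List Bool :=
  takeFn ∘ fanoutFn (sndF ∘ dmF qD pd) (dropFn ∘ fanoutFn (fstF ∘ dmF qD pd) sndF)
/-- `1^{d n}`. [folklore] -/
noncomputable def DvF : List Bool → List Bool := dF d ∘ uF
/-- The query `⟨1^{d n + |z|}, y ↾ (d n + 1) ++ z⟩`. [folklore] -/
noncomputable def qF : List Bool → List Bool :=
  fanoutFn (concatFn ∘ fanoutFn (DvF d) (onesFn ∘ zF qD pd))
    (concatFn ∘ fanoutFn (takeFn ∘ fanoutFn (List.cons true ∘ DvF d) (sndF ∘ fstF)) (zF qD pd))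
/-- **The whole run function on `⟨inp, r⟩`**, Boolean output encoded: `[D(query; coins)]`. [folklore] -/
noncomputable def runF : List Bool → List Bool :=
  (fun q => encodeBool (D.run (fstF q) (sndF q))) ∘ fanoutFn (qF d qD pd) (rAF qD pd)

variable {d D qD pd}

/-- `onesFn w = 1^{|w|}`. [folklore] -/
private theorem onesFn_eq_ones (w : List Bool) : onesFn w = ones w.length := by
  simp [onesFn, Complexity.unaryEncodeNat_eq_replicate, ones]

/-- **The pipeline computes the run function** (on every pair: both sides only read `boolUnpair inp`). [folklore] -/
theorem runF_boolPair (inp r : List Bool) : runF d D qD pd (boolPair inp r) = encodeBool (advRun d D qD pd inp r) := by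
  set n := (boolUnpair inp).1.length with hn
  set j := r.length / K qD pd n with hj
  set κ := r.length % K qD pd n with hκ
  have hu : uF (boolPair inp r) = ones n := by
    rw [uF, Function.comp_apply, Function.comp_apply, fstF_boolPair, onesFn_eq_ones]; rfl
  have hk : kF qD pd (boolPair inp r) = ones (K qD pd n) := by
    rw [kF, Function.comp_apply, hu, polyFn_apply, List.length_replicate]; rfl
  have hdm : dmF qD pd (boolPair inp r) = boolPair (ones j) (ones κ) := by
    rw [dmF, Function.comp_apply, fanoutFn_apply, hk, Function.comp_apply, sndF_boolPair, onesFn_eq_ones,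
      divModFn_boolPair]
  have hz : zF qD pd (boolPair inp r) = r.take j := by
    rw [zF, Function.comp_apply, fanoutFn_apply, Function.comp_apply, hdm, fstF_boolPair, sndF_boolPair, takeFn_boolPair,
      List.length_replicate]
  have hrA : rAF qD pd (boolPair inp r) = (r.drop j).take κ := by
    rw [rAF, Function.comp_apply, fanoutFn_apply, Function.comp_apply, hdm, sndF_boolPair, Function.comp_apply,
      fanoutFn_apply, Function.comp_apply, hdm, fstF_boolPair, sndF_boolPair, dropFn_boolPair, takeFn_boolPair,
      List.length_replicate, List.length_replicate]
  have hDv : DvF d (boolPair inp r) = ones (d n) := by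
    rw [DvF, Function.comp_apply, hu, dF, List.length_replicate]
  have hq1 : (concatFn ∘ fanoutFn (DvF d) (onesFn ∘ zF qD pd)) (boolPair inp r) =
      unaryEncodeNat (d n + (r.take j).length) := by
    rw [Function.comp_apply, fanoutFn_apply, hDv, Function.comp_apply, hz, onesFn_eq_ones, concatFn_boolPair,
      Complexity.unaryEncodeNat_eq_replicate]
    exact List.replicate_append_replicate
  have hq2 : (concatFn ∘ fanoutFn (takeFn ∘ fanoutFn (List.cons true ∘ DvF d) (sndF ∘ fstF)) (zF qD pd)) (boolPair inp r) =
      (boolUnpair inp).2.take (d n + 1) ++ r.take j := by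
    rw [Function.comp_apply, fanoutFn_apply, Function.comp_apply, fanoutFn_apply, Function.comp_apply, hDv,
      Function.comp_apply, fstF_boolPair, hz, takeFn_boolPair, concatFn_boolPair, List.length_cons, List.length_replicate]
    rfl
  have hq : qF d qD pd (boolPair inp r) = query d n (boolUnpair inp).2 (r.take j) := by
    rw [qF, fanoutFn_apply, hq1, hq2]
    rfl
  rw [runF, Function.comp_apply, fanoutFn_apply, hq, hrA, fstF_boolPair, sndF_boolPair]
  rfl

/-- `runF ∈ FP` for a PPT `D` and a schedule computable in unary. [Arora–Barak 2009, §1.3 (composition)] [folklore] -/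
theorem runF_mem_FP (hD : IsPPT D encodeBool) (hdF : dF d ∈ FP) : runF d D qD pd ∈ FP := by
  have hu : uF ∈ FP := comp_mem_FP onesFn_mem_FP (comp_mem_FP fstF_mem_FP fstF_mem_FP)
  have hk : kF qD pd ∈ FP := comp_mem_FP (polyFn_mem_FP _) hu
  have hdm : dmF qD pd ∈ FP := comp_mem_FP divModFn_mem_FP (fanoutFn_mem_FP hk (comp_mem_FP onesFn_mem_FP sndF_mem_FP))
  have hz : zF qD pd ∈ FP := comp_mem_FP takeFn_mem_FP (fanoutFn_mem_FP (comp_mem_FP fstF_mem_FP hdm) sndF_mem_FP)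
  have hrA : rAF qD pd ∈ FP := comp_mem_FP takeFn_mem_FP (fanoutFn_mem_FP (comp_mem_FP sndF_mem_FP hdm)
    (comp_mem_FP dropFn_mem_FP (fanoutFn_mem_FP (comp_mem_FP fstF_mem_FP hdm) sndF_mem_FP)))
  have hDv : DvF d ∈ FP := comp_mem_FP hdF hu
  have hq : qF d qD pd ∈ FP :=
    fanoutFn_mem_FP (comp_mem_FP concatFn_mem_FP (fanoutFn_mem_FP hDv (comp_mem_FP onesFn_mem_FP hz)))
      (comp_mem_FP concatFn_mem_FP (fanoutFn_mem_FP (comp_mem_FP takeFn_mem_FP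
        (fanoutFn_mem_FP (comp_mem_FP (cons_mem_FP true) hDv) (comp_mem_FP sndF_mem_FP fstF_mem_FP))) hz))
  exact comp_mem_FP (Hybrid.distFn_mem_FP hD) (fanoutFn_mem_FP hq hrA)

/-- **`D'` is PPT** for a PPT `D`, a schedule computable in unary and a polynomially bounded coin budget.
[Goldreich 2001, §1.3.2; Arora–Barak 2009, §7.1] [folklore] -/
theorem adv_isPPT (hD : IsPPT D encodeBool) (hdF : dF d ∈ FP) {cl : ℕ → ℕ}
    (hcl : ∃ pc : Polynomial ℕ, ∀ ℓ, cl ℓ ≤ pc.eval ℓ) : IsPPT (adv d D qD pd cl) encodeBool := by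
  refine ⟨?_, hcl⟩
  exact PolyTimeComputable.of_encode_eq (f := runF d D qD pd)
    (fun p : List Bool × List Bool => boolPair p.1 p.2) (fun _ => rfl) (fun p => runF_boolPair p.1 p.2)
    (runF_mem_FP hD hdF)

end Adversary

/-! ### The advice (which offset of a level to attack, `D`'s coin count) and the selector -/

/-- The data of the reduction: the schedule `d`, the output lengths `r`, the level-indexed generator
`S`, the distinguisher `D` for the extension with a polynomial bound `qD` on its coin budget, and a
polynomial bound `pd` on the schedule. [folklore] -/
structure Setting where
  /-- the schedule of seed lengths [folklore] -/
  d : ℕ → ℕ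
  /-- the output lengths of the level-indexed generator [folklore] -/
  r : ℕ → ℕ
  /-- the level-indexed generator, run on `⟨1ⁿ, seed⟩` [folklore] -/
  S : List Bool → List Bool
  /-- the distinguisher for the extension [folklore] -/
  D : RandAlg (List Bool) Bool
  /-- a polynomial bound on `D`'s coin budget [folklore] -/
  qD : Polynomial ℕ
  /-- a polynomial bound on the schedule [folklore] -/
  pd : Polynomial ℕ

namespace Setting

open scoped Classical

variable (T : Setting)

/-- The advantage of `D` against the extension on seed length `m`: `ext(U_m)` versus `U_{m+1}`. [folklore] -/
noncomputable def advT (m : ℕ) : ℝ :=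
  distAdvantage T.D (fun m => (uniformBits m).map (ext T.d T.S)) (uniformEnsemble (· + 1)) m

/-- **The advice `j(n)`**: an offset of level `n` on which `D` does best (`0` if the level is empty). [folklore] -/
noncomputable def jA (n : ℕ) : ℕ :=
  if h : (Finset.range (T.d (n + 1) - T.d n)).Nonempty then
    Classical.choose (Finset.exists_max_image _ (fun j => T.advT (T.d n + j)) h) else 0

/-- The advantage at the advised length of level `n`. [folklore] -/
noncomputable def advL (n : ℕ) : ℝ := T.advT (T.d n + T.jA n)

/-- The advice `κ(n)`: `D`'s coin count on the queries of level `n`. [folklore] -/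
noncomputable def κA (n : ℕ) : ℕ := T.D.coinLen (3 * (T.d n + T.jA n) + 3)

/-- **The coin count encoding the advice**: `Code n = j(n) · K n + κ(n)`. [folklore] -/
noncomputable def Code (n : ℕ) : ℕ := T.jA n * K T.qD T.pd n + T.κA n

/-- A polynomial bound on `Code`. [folklore] -/
noncomputable def CodePoly : Polynomial ℕ := T.pd.comp (X + 1) * Kpoly T.qD T.pd + Kpoly T.qD T.pd

/-- **The selector**: for an input length `L` of `D'`, the level in the collision class
`{n : 2n + 2 + r n = L}` with the largest advised advantage (`PRGTake.sel` of
`PseudorandomGeneratorsStretchOne.lean`). [folklore] -/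
noncomputable def σ (L : ℕ) : ℕ := PRGTake.sel T.r T.advL L

/-- **The coin budget of `D'`**: `Code` of the selected level. [folklore] -/
noncomputable def cl (L : ℕ) : ℕ := T.Code (T.σ L)

/-- The distinguisher of the setting. [folklore] -/
noncomputable def inv : RandAlg (List Bool) Bool := adv T.d T.D T.qD T.pd T.cl

variable {T}

/-- The advised offset lies in level `n` (for a strictly increasing schedule). [folklore] -/
theorem jA_lt (hd : StrictMono T.d) (n : ℕ) : T.d n + T.jA n < T.d (n + 1) := by
  have hlt := hd (Nat.lt_succ_self n)
  have hne : (Finset.range (T.d (n + 1) - T.d n)).Nonempty := ⟨0, by simp; omega⟩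
  unfold jA
  rw [dif_pos hne]
  have h := (Classical.choose_spec (Finset.exists_max_image _ (fun j => T.advT (T.d n + j)) hne)).1
  rw [Finset.mem_range] at h
  omega

/-- **The advised length is one where `D` does best within the level.** [folklore] -/
theorem advT_le_advL (hd : StrictMono T.d) {n j : ℕ} (hj : T.d n + j < T.d (n + 1)) : T.advT (T.d n + j) ≤ T.advL n := by
  have hne : (Finset.range (T.d (n + 1) - T.d n)).Nonempty := ⟨0, by simp; have := hd (Nat.lt_succ_self n); omega⟩
  unfold advL jA
  rw [dif_pos hne]
  exact (Classical.choose_spec (Finset.exists_max_image _ (fun j => T.advT (T.d n + j)) hne)).2 j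
    (Finset.mem_range.2 (by omega))

/-- `κ(n) < K n` when `qD` bounds `D`'s coin budget and `pd` the schedule. [folklore] -/
theorem κA_lt (hd : StrictMono T.d) (hqD : ∀ ℓ, T.D.coinLen ℓ ≤ T.qD.eval ℓ) (hpd : ∀ n, T.d n ≤ T.pd.eval n) (n : ℕ) :
    T.κA n < K T.qD T.pd n := by
  rw [K_eq, κA, Nat.lt_succ_iff]
  refine (hqD _).trans (TM2Iter.eval_mono _ ?_)
  have h1 := jA_lt hd n
  have h2 := hpd (n + 1)
  omega

/-- Decoding the advice: `Code n / K n = j(n)`. [folklore] -/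
theorem Code_div (hd : StrictMono T.d) (hqD : ∀ ℓ, T.D.coinLen ℓ ≤ T.qD.eval ℓ) (hpd : ∀ n, T.d n ≤ T.pd.eval n) (n : ℕ) :
    T.Code n / K T.qD T.pd n = T.jA n := by
  have hK := κA_lt hd hqD hpd n
  rw [Code, Nat.add_comm, Nat.add_mul_div_right _ _ (by omega), Nat.div_eq_of_lt hK, Nat.zero_add]

/-- Decoding the advice: `Code n mod K n = κ(n)`. [folklore] -/
theorem Code_mod (hd : StrictMono T.d) (hqD : ∀ ℓ, T.D.coinLen ℓ ≤ T.qD.eval ℓ) (hpd : ∀ n, T.d n ≤ T.pd.eval n) (n : ℕ) :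
    T.Code n % K T.qD T.pd n = T.κA n := by
  have hK := κA_lt hd hqD hpd n
  rw [Code, Nat.add_comm, Nat.add_mul_mod_self_right, Nat.mod_eq_of_lt hK]

/-- `j(n) + κ(n) ≤ Code n`. [folklore] -/
theorem jA_add_κA_le (hd : StrictMono T.d) (hqD : ∀ ℓ, T.D.coinLen ℓ ≤ T.qD.eval ℓ) (hpd : ∀ n, T.d n ≤ T.pd.eval n)
    (n : ℕ) : T.jA n + T.κA n ≤ T.Code n := by
  have hK : 1 ≤ K T.qD T.pd n := by have := κA_lt hd hqD hpd n; omega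
  unfold Code
  nlinarith

/-- `Code n ≤ CodePoly(n)`. [folklore] -/
theorem Code_le (hd : StrictMono T.d) (hqD : ∀ ℓ, T.D.coinLen ℓ ≤ T.qD.eval ℓ) (hpd : ∀ n, T.d n ≤ T.pd.eval n) (n : ℕ) :
    T.Code n ≤ T.CodePoly.eval n := by
  have h1 : T.jA n ≤ T.pd.eval (n + 1) := by have := jA_lt hd n; have := hpd (n + 1); omega
  have h2 := (κA_lt hd hqD hpd n).le
  simp only [Code, CodePoly, eval_add, eval_mul, eval_comp, eval_X, eval_one]
  unfold K at h2 ⊢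
  exact Nat.add_le_add (Nat.mul_le_mul_right _ h1) h2

/-- The coin budget is polynomially bounded (the selected level never exceeds the input length). [folklore] -/
theorem cl_le (hd : StrictMono T.d) (hqD : ∀ ℓ, T.D.coinLen ℓ ≤ T.qD.eval ℓ) (hpd : ∀ n, T.d n ≤ T.pd.eval n) (L : ℕ) :
    T.cl L ≤ T.CodePoly.eval L :=
  (Code_le hd hqD hpd _).trans (TM2Iter.eval_mono _ (PRGTake.sel_le T.r T.advL L))

/-- **On the inputs of a selected level `n` the budget is `Code n`.** [folklore] -/
theorem cl_eq {n : ℕ} (hσ : T.σ (2 * n + 2 + T.r n) = n) : T.cl (2 * n + 2 + T.r n) = T.Code n := by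
  rw [cl, hσ]

/-- The distinguisher is PPT. [folklore] -/
theorem isPPT_inv (hd : StrictMono T.d) (hD : IsPPT T.D encodeBool) (hdF : dF T.d ∈ FP)
    (hqD : ∀ ℓ, T.D.coinLen ℓ ≤ T.qD.eval ℓ) (hpd : ∀ n, T.d n ≤ T.pd.eval n) : IsPPT T.inv encodeBool :=
  adv_isPPT hD hdF ⟨T.CodePoly, cl_le hd hqD hpd⟩

end Setting

/-! ### Counting: the new distinguisher plays `D`'s game on the advised length -/

section Counting

variable {T : Setting}

/-- **The acceptance probability of `D'` on `⟨1ⁿ, y⟩`, `|y| = r n`, when its budget is `Code n`**: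
the average over the suffix `z ← U_{j(n)}` of `Pr[D(⟨1^{d n + j(n)}, y ↾ (d n + 1) ++ z⟩) = 1]` (the
coins of `D'` enumerate (`z`, coins of `D`, unused coins)). [folklore] -/
theorem pr_adv_eq (hd : StrictMono T.d) (hr : ∀ n, T.d n + 1 ≤ T.r n) (hqD : ∀ ℓ, T.D.coinLen ℓ ≤ T.qD.eval ℓ)
    (hpd : ∀ n, T.d n ≤ T.pd.eval n) {n : ℕ} {cl : ℕ → ℕ} (hcl : cl (2 * n + 2 + T.r n) = T.Code n)
    {y : List Bool} (hy : y.length = T.r n) :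
    (adv T.d T.D T.qD T.pd cl).pr id (boolPair (unaryEncodeNat n) y) {true} =
      uniformAvg (T.jA n) (fun z => T.D.pr id (query T.d n y z) {true}) := by
  set j := T.jA n with hj
  set κ := T.κA n with hκ
  obtain ⟨e, he⟩ : ∃ e, T.Code n = j + (κ + e) := by
    obtain ⟨e, he⟩ := Nat.exists_eq_add_of_le (Setting.jA_add_κA_le hd hqD hpd n)
    exact ⟨e, by rw [he]; ring⟩
  have hc : (adv T.d T.D T.qD T.pd cl).coinLen (id (boolPair (unaryEncodeNat n) y)).length = j + (κ + e) := by
    rw [id, length_boolPair, length_unaryEncodeNat, hy, ← he]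
    exact hcl
  have hrun : ∀ r : List Bool, r.length = j + (κ + e) →
      (adv T.d T.D T.qD T.pd cl).run (boolPair (unaryEncodeNat n) y) r =
        T.D.run (query T.d n y (r.take j)) ((r.drop j).take κ) := by
    intro r hr'
    show advRun T.d T.D T.qD T.pd (boolPair (unaryEncodeNat n) y) r = _
    rw [advRun_boolPair, advCore, hr', ← he, Setting.Code_div hd hqD hpd, Setting.Code_mod hd hqD hpd]
  rw [RandAlg.pr_true_eq_uniformAvg _ id _ hc,
    uniformAvg_congr (m := j + (κ + e))
      (g := fun r => (fun z r' => if T.D.run (query T.d n y z) (r'.take κ) = true then (1 : ℝ) else 0) (r.take j) (r.drop j))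
      (fun r hr' => by simp only [hrun r hr']),
    uniformAvg_add j (κ + e) (fun z r' => if T.D.run (query T.d n y z) (r'.take κ) = true then (1 : ℝ) else 0)]
  refine uniformAvg_congr fun z hz => ?_
  rw [uniformAvg_take κ e (fun rD => if T.D.run (query T.d n y z) rD = true then (1 : ℝ) else 0)]
  have hk : T.D.coinLen (id (query T.d n y z)).length = κ := by
    rw [id, length_query (by rw [hy]; exact hr n), hz]
    rfl
  rw [RandAlg.pr_true_eq_uniformAvg _ id _ hk]

/-- **The real game**: on the level-indexed ensemble, `D'` accepts exactly as `D` does on the extension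
at the advised seed length `d n + j(n)` (a level-`n` output with a uniform suffix is a sample of the
extension, `ext_append`). [folklore] -/
theorem toReal_acceptPMF_adv_level (hd : StrictMono T.d) (hS : OutLen T.d T.r T.S) (hr : ∀ n, T.d n + 1 ≤ T.r n)
    (hqD : ∀ ℓ, T.D.coinLen ℓ ≤ T.qD.eval ℓ) (hpd : ∀ n, T.d n ≤ T.pd.eval n) {n : ℕ} {cl : ℕ → ℕ}
    (hcl : cl (2 * n + 2 + T.r n) = T.Code n) :
    (acceptPMF (adv T.d T.D T.qD T.pd cl) n (levelEnsemble T.d T.S n) true).toReal =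
      (acceptPMF T.D (T.d n + T.jA n) ((uniformBits (T.d n + T.jA n)).map (ext T.d T.S)) true).toReal := by
  have hL : (acceptPMF (adv T.d T.D T.qD T.pd cl) n (levelEnsemble T.d T.S n) true).toReal =
      uniformAvg (T.d n) (fun s => uniformAvg (T.jA n)
        (fun z => T.D.pr id (query T.d n (T.S (boolPair (unaryEncodeNat n) s)) z) {true})) := by
    unfold acceptPMF levelEnsemble
    rw [PMF.bind_map, bind_uniformBits_apply_toReal]
    refine uniformAvg_congr fun s hs => ?_
    rw [Function.comp_apply, ← pr_true_eq_toReal, pr_adv_eq hd hr hqD hpd hcl (hS n s hs)]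
  have hR : (acceptPMF T.D (T.d n + T.jA n) ((uniformBits (T.d n + T.jA n)).map (ext T.d T.S)) true).toReal =
      uniformAvg (T.d n) (fun s => uniformAvg (T.jA n)
        (fun z => T.D.pr id (query T.d n (T.S (boolPair (unaryEncodeNat n) s)) z) {true})) := by
    unfold acceptPMF
    rw [PMF.bind_map, bind_uniformBits_apply_toReal, uniformAvg_append (T.d n) (T.jA n)]
    refine uniformAvg_congr fun s hs => uniformAvg_congr fun z hz => ?_
    rw [Function.comp_apply, ← pr_true_eq_toReal, ext_append hd (Setting.jA_lt hd n) hs hz, query, hz]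
  rw [hL, hR]

/-- **The ideal game**: on `U_{r n}`, `D'` accepts exactly as `D` does on `U_{d n + j(n) + 1}` (a prefix
of a uniform string with a uniform suffix is uniform). [folklore] -/
theorem toReal_acceptPMF_adv_uniform (hd : StrictMono T.d) (hr : ∀ n, T.d n + 1 ≤ T.r n)
    (hqD : ∀ ℓ, T.D.coinLen ℓ ≤ T.qD.eval ℓ) (hpd : ∀ n, T.d n ≤ T.pd.eval n) {n : ℕ} {cl : ℕ → ℕ}
    (hcl : cl (2 * n + 2 + T.r n) = T.Code n) :
    (acceptPMF (adv T.d T.D T.qD T.pd cl) n (uniformBits (T.r n)) true).toReal =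
      (acceptPMF T.D (T.d n + T.jA n) (uniformBits (T.d n + T.jA n + 1)) true).toReal := by
  obtain ⟨e', he'⟩ := Nat.exists_eq_add_of_le (hr n)
  -- the common value
  set Ψ : List Bool → ℝ := fun y' => uniformAvg (T.jA n)
    (fun z => T.D.pr id (boolPair (unaryEncodeNat (T.d n + z.length)) (y' ++ z)) {true}) with hΨ
  have hL : (acceptPMF (adv T.d T.D T.qD T.pd cl) n (uniformBits (T.r n)) true).toReal = uniformAvg (T.d n + 1) Ψ := by
    rw [toReal_acceptPMF_uniformBits, uniformAvg_congr (fun y hy => pr_adv_eq hd hr hqD hpd hcl hy), he']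
    exact uniformAvg_take (T.d n + 1) e' Ψ
  have hR : (acceptPMF T.D (T.d n + T.jA n) (uniformBits (T.d n + T.jA n + 1)) true).toReal = uniformAvg (T.d n + 1) Ψ := by
    rw [toReal_acceptPMF_uniformBits, Nat.add_right_comm, uniformAvg_append (T.d n + 1) (T.jA n)]
    refine uniformAvg_congr fun y' _ => uniformAvg_congr fun z hz => ?_
    rw [hz]
  rw [hL, hR]

/-- **The advantages agree**: at a level `n` where the budget is `Code n`, `D'` has against the
level-indexed ensemble versus `U_{r n}` exactly the advantage of `D` against the extension at the advised
seed length. [folklore] -/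
theorem distAdvantage_adv (hd : StrictMono T.d) (hS : OutLen T.d T.r T.S) (hr : ∀ n, T.d n + 1 ≤ T.r n)
    (hqD : ∀ ℓ, T.D.coinLen ℓ ≤ T.qD.eval ℓ) (hpd : ∀ n, T.d n ≤ T.pd.eval n) {n : ℕ} {cl : ℕ → ℕ}
    (hcl : cl (2 * n + 2 + T.r n) = T.Code n) :
    distAdvantage (adv T.d T.D T.qD T.pd cl) (levelEnsemble T.d T.S) (uniformEnsemble T.r) n = T.advL n := by
  unfold distAdvantage Setting.advL Setting.advT uniformEnsemble distAdvantage
  rw [toReal_acceptPMF_adv_level hd hS hr hqD hpd hcl, toReal_acceptPMF_adv_uniform hd hr hqD hpd hcl]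

end Counting

/-! ### The main theorem -/

section Main

/-- The output lengths of a polynomial-time level-indexed generator are polynomially bounded. [folklore] -/
theorem exists_poly_r_le (hSFP : S ∈ FP) (hS : OutLen d r S) {pd : Polynomial ℕ} (hpd : ∀ n, d n ≤ pd.eval n) :
    ∃ pr : Polynomial ℕ, ∀ n, r n ≤ pr.eval n := by
  obtain ⟨ps, hps⟩ := exists_poly_length_le_of_mem_FP hSFP
  refine ⟨ps.comp (C 2 * X + C 2 + pd), fun n => ?_⟩
  have h := hps (boolPair (unaryEncodeNat n) (List.replicate (d n) false))
  have hlen : (unaryEncodeNat n).length = n := unary_decode_encode_nat n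
  rw [hS n _ (List.length_replicate ..), length_boolPair, List.length_replicate, hlen] at h
  refine h.trans ?_
  rw [eval_comp]
  refine TM2Iter.eval_mono _ ?_
  simp only [eval_add, eval_mul, eval_C, eval_X]
  have := hpd n
  omega

/-- **The extension is pseudorandom.** Let `d` be a strictly increasing schedule computable in unary,
`S ∈ FP` a level-indexed generator with `|S⟨1ⁿ, s⟩| = r n ≥ d n + 1` on `|s| = d n`, and suppose
`n ↦ S⟨1ⁿ, U_{d n}⟩` is pseudorandom against `U_{r n}`. Then `m ↦ ext d S (U_m)` is pseudorandom against
`U_{m+1}`: a PPT distinguisher `D` with advantage `adv_D(m)` is turned into `D'` (with the advice-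
carrying budget of the selected levels); for every `m ≥ d 0`, with `n = dOf m` and `n'` the selected
level of the class of `n`, `adv_D(m) ≤ adv_D(d n + j(n)) ≤ adv_D(d n' + j(n')) = adv_{D'}(n')`
(`advT_le_advL`, `PRGTake.le_adv_sel`, `distAdvantage_adv`), the right side is negligible in `n'`,
and `m ≤ pd(n' + 2 + pr(n'))` — negligibility is stable under this re-indexing
(`superpolynomialDecay_of_le_comp`). [Goldreich 2001, Prop. 2.2.3 (the argument for `g'`, eq. (2.2)),
adapted to generators] [folklore] -/
theorem isPseudorandom_ext (hd : StrictMono d) (hdF : dF d ∈ FP) (hSFP : S ∈ FP) (hS : OutLen d r S)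
    (hr : ∀ n, d n + 1 ≤ r n) (hps : IsPseudorandom (levelEnsemble d S) r) :
    IsPseudorandom (fun m => (uniformBits m).map (ext d S)) (· + 1) := by
  intro D hD
  obtain ⟨qD, hqD⟩ := hD.2
  obtain ⟨pd, hpd⟩ := exists_poly_d_le hdF
  obtain ⟨pr, hpr⟩ := exists_poly_r_le hSFP hS hpd
  let T : Setting := ⟨d, r, S, D, qD, pd⟩
  have hPPT : IsPPT T.inv encodeBool := Setting.isPPT_inv hd hD hdF hqD hpd
  have hneg := hps T.inv hPPT
  set advD : ℕ → ℝ := distAdvantage D (fun m => (uniformBits m).map (ext d S)) (uniformEnsemble (· + 1)) with hadvD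
  -- the class representative of the level of `m`
  set τ : ℕ → ℕ := fun m => PRGTake.sel r T.advL (2 * dOf d m + 2 + r (dOf d m)) with hτ
  have hστ : ∀ m, T.σ (2 * τ m + 2 + T.r (τ m)) = τ m := fun m => by
    show PRGTake.sel r T.advL (2 * τ m + 2 + r (τ m)) = τ m
    simp only [hτ]
    rw [PRGTake.len_sel_eq r T.advL (dOf d m)]
  have key : SuperpolynomialDecay atTop (fun m : ℕ => (m : ℝ)) (fun m => if d 0 ≤ m then advD m else 0) := by
    refine superpolynomialDecay_of_le_comp (τ := τ) (pd.comp (X + C 2 + pr)) hneg (fun m => ?_) (fun m => ?_)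
    · -- `m ≤ pd(τ m + 2 + pr(τ m))`
      have hcls : 2 * τ m + 2 + r (τ m) = 2 * dOf d m + 2 + r (dOf d m) := PRGTake.len_sel_eq r T.advL (dOf d m)
      have h1 : m < d (dOf d m + 1) := lt_d_dOf_succ hd m
      have h2 := hpd (dOf d m + 1)
      have h3 := hpr (τ m)
      have h4 : dOf d m + 1 ≤ τ m + 2 + pr.eval (τ m) := by omega
      calc m ≤ pd.eval (dOf d m + 1) := by omega
        _ ≤ pd.eval (τ m + 2 + pr.eval (τ m)) := TM2Iter.eval_mono _ h4
        _ = (pd.comp (X + C 2 + pr)).eval (τ m) := by simp [eval_comp]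
    · -- `|adv_D m| ≤ |adv_{D'} (τ m)|`
      split_ifs with h0
      · have hn : d (dOf d m) ≤ m := d_dOf_le h0
        have hlt : m < d (dOf d m + 1) := lt_d_dOf_succ hd m
        have hm' : T.d (dOf d m) + (m - d (dOf d m)) = m := by
          show d (dOf d m) + (m - d (dOf d m)) = m
          omega
        rw [abs_of_nonneg (distAdvantage_nonneg _ _ _ _), abs_of_nonneg (distAdvantage_nonneg _ _ _ _)]
        calc advD m = T.advT m := rfl
          _ = T.advT (T.d (dOf d m) + (m - d (dOf d m))) := by rw [hm']
          _ ≤ T.advL (dOf d m) :=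
              Setting.advT_le_advL hd (by show d (dOf d m) + (m - d (dOf d m)) < d (dOf d m + 1); omega)
          _ ≤ T.advL (τ m) := PRGTake.le_adv_sel r T.advL (dOf d m)
          _ = distAdvantage T.inv (levelEnsemble d S) (uniformEnsemble r) (τ m) :=
              (distAdvantage_adv (T := T) hd hS hr hqD hpd (Setting.cl_eq (hστ m))).symm
      · rw [abs_zero]; exact abs_nonneg _
  intro z
  refine (key z).congr' ?_
  filter_upwards [eventually_ge_atTop (d 0)] with m hm
  rw [if_pos hm]

/-- **`ext d S` is a pseudorandom generator of stretch `m + 1`** under the hypotheses of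
`isPseudorandom_ext`. [Goldreich 2001, Def. 3.3.1; Prop. 2.2.3 adapted to generators] [folklore] -/
theorem isPRG_ext (hd : StrictMono d) (hdF : dF d ∈ FP) (hSFP : S ∈ FP) (hS : OutLen d r S)
    (hr : ∀ n, d n + 1 ≤ r n) (hps : IsPseudorandom (levelEnsemble d S) r) : IsPRG (ext d S) (· + 1) :=
  ⟨ext_mem_FP hd hdF hSFP, fun n => Nat.lt_succ_self n, length_ext hS hr, isPseudorandom_ext hd hdF hSFP hS hr hps⟩

end Main

end PRGExt

/-- **Pseudorandom generators on a sparse schedule of seed lengths give pseudorandom generators**: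
if a polynomial-time `S`, run as `S⟨1ⁿ, s⟩` on seeds `s` of length `d n` — `d` strictly increasing and
computable in unary in polynomial time — has outputs of length `r n ≥ d n + 1` and `n ↦ S⟨1ⁿ, U_{d n}⟩`
is pseudorandom against `U_{r n}`, then pseudorandom generators (for every seed length, Goldreich's
Def. 3.3.1) exist: `PRGExt.ext d S` is one, of stretch `m + 1`. This is the length convention behind
statements such as "there exists a polynomial-time computable generator `G : {0,1}^d → {0,1}^{d(1+…)}`
with seed length `d = d(n)`" (Haitner–Reingold–Vadhan 2013, Thms. 5.1 and 6.1).
[Goldreich 2001, §2.2.3.1, Prop. 2.2.3 (eq. (2.2)), adapted to generators; Def. 3.3.1] [folklore] -/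
theorem PRGExist_of_levels {d r : ℕ → ℕ} {S : List Bool → List Bool} (hd : StrictMono d)
    (hdF : PRGExt.dF d ∈ FP) (hSFP : S ∈ FP) (hS : PRGExt.OutLen d r S) (hr : ∀ n, d n + 1 ≤ r n)
    (hps : IsPseudorandom (PRGExt.levelEnsemble d S) r) : PRGExist :=
  ⟨PRGExt.ext d S, (· + 1), PRGExt.isPRG_ext hd hdF hSFP hS hr hps⟩

end Literature.Computability.Cryptography
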